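/-
Copyright: harness cell b2b-lgcu-borel (gen 16).  Honest framing: the VALUE here is a THEOREM
(all primes; conditional on the named classical hypothesis `DicksonList` of `DicksonReduction`
where marked) — NOT summit progress; the crux item `SubgroupIdentityDesigns`
(stmt-MatrixMultiplication-14079) stays open and untouched.
-/
import Mathlib
import Summits.MatrixMultiplication.MatrixMultiplication.Theorems.SubgroupIdentityDesigns.Negative.FamilyIArithmetic
import Summits.MatrixMultiplication.MatrixMultiplication.Theorems.SubgroupIdentityDesigns.Negative.LogGapWindow
import Summits.MatrixMultiplication.MatrixMultiplication.Theorems.SubgroupIdentityDesigns.Negative.WitnessProfile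

/-!
# Status of the `(2,1)` cell modulo Dickson: primes `47, 53, 59` and the `ε`-thresholds

Route `LevelGradedCohnUmans`, crux `SubgroupIdentityDesigns`, negative side, cell `(m,k) = (2,1)`.
This file closes, modulo Dickson (`DicksonList p n`, Serre's Cartan-normaliser form, a named
hypothesis, NOT proved), everything the unconditional engines + `DicksonReduction` /
`DicksonFamilyI` / `FamilyIArithmetic` / `LogGapWindow` give for the `(2,1)` cell and `0 < ε ≤ 1`:

* SMALL PRIMES `47, 53, 59` (new, all `0 < ε ≤ 1`): with `WitnessProfile.card_dvd_of_not_dvd` (a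
  `p`-free subgroup has order dividing `(p-1)²(p+1)`, from `|GL₂(𝔽_p)| = p(p-1)²(p+1)`),
  `image_le_of_dicksonList_small` — under Dickson, at a prime where every divisor `≤ 60` of
  `(p-1)²(p+1)` is `≤ p + 1` (a decidable arithmetic fact, true at `p = 47, 53` and trivially for
  `p ≥ 59`), a `p`-free subgroup with a free vector has projective image of order `≤ p + 1` (the
  exceptional branch `|HZ/Z| ≤ 60` of Dickson's list is tamed by divisibility); hence
  **`no_levelOne_witness_of_dicksonList_small`** (`p ≥ 7`, that arithmetic fact, `ω(p-1) ≤ 2`):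
  NO `(2,1)` witness for any `0 < ε ≤ 1`; instances **`p = 47`** (`46 = 2·23`), **`p = 53`**
  (`52 = 2²·13`), **`p = 59`** (`58 = 2·29`);
* `ε`-THRESHOLDS: `no_levelOne_witness_of_dicksonList_log` (`p ≥ 59`, `0 < ε < 1`: NO witness whenever
  `3/(1-ε) ≤ (p-2) log(p-1)`); **`no_levelOne_witness_of_dicksonList_explicit`** — for `0 < ε < 1`
  NO witness at any `p ≥ max(61, 2 + 3/(4(1-ε)))`; **`…_sharp`** — none at all for
  `0 < ε ≤ 233/236 ≈ 0.9873` (improving the `49/50` of `DicksonReduction`);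
  **`witness_status_of_dicksonList`** — packaged: a witness at `p ≥ 61` forces `ε > 233/236`,
  `p < 2 + 3/(4(1-ε))` (if `ε < 1`), `p ≡ 1 (mod 4)`, `ω(p-1) ≥ 3`;
* ONE STATEMENT FOR ALL `p ≥ 47`: **`witness_status_of_dicksonList_of_fortyseven_le`** — a
  witness forces `p ≥ 61` and all of the above (`eq_of_prime_of_fortyseven_le`: the primes in
  `[47, 61)` are `47, 53, 59`).

NET, modulo Dickson, for the `(2,1)` cell, `0 < ε ≤ 1` and primes `p ≥ 47`: EMPTY at
`p = 47, 53, 59` and at every `p ≥ 61` with `p ≢ 1 (mod 4)` or `ω(p-1) ≤ 2`; EMPTY everywhere for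
`ε ≤ 233/236`; otherwise confined to family-I triples at the finitely many primes
`61 ≤ p < 2 + 3/(4(1-ε))` (`ε < 1`) with `p ≡ 1 (mod 4)`, `ω(p-1) ≥ 3` — `61, 157, 181, 229, 241,
277, 281, 313, 337, …` — exactly the survivor list of the order-profile sieve (ORACLE-g16 §G16-2,
DATA), whose status rests on design-existence DATA (`p = 61`: none, exhaustive census §G16-4).
Primes `p ≤ 43` are NOT covered here (the sieve + the `p = 31` census are DATA).

VALUE = THEOREM (conditional on `DicksonList` where stated), NOT summit progress; the crux item is
untouched and remains open.  Report: `run/shared/lean/b2b/levelgraded-cu/ORACLE-g16.md` §G16-1/6.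
-/

set_option linter.dupNamespace false

noncomputable section

open scoped Classical
open Summit.MatrixMultiplication.MatrixMultiplication.Theorems.LieRankDesigns.Negative (GLm Mat budget)
open Literature.Barriers.MatrixMultiplication (SubgroupTPP)

namespace Summit.MatrixMultiplication.MatrixMultiplication.Theorems.SubgroupIdentityDesigns.Negative

section CellTwoOneStatus

variable {p : ℕ} [hp : Fact p.Prime]

/-! ## Small primes: the exceptional branch tamed by divisibility -/

/-- **Image bound at a small prime, mod Dickson**: if every divisor `v ≤ 60` of `(p-1)²(p+1)` is
`≤ p + 1` (true at `p = 47, 53` and for all `p ≥ 59`), then under Dickson's list a `p`-free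
subgroup with a free vector has projective image of order `≤ p + 1` (`p ≥ 3`). -/
theorem image_le_of_dicksonList_small (hp3 : 3 ≤ p)
    (hP : ∀ v : ℕ, v ∣ (p - 1) ^ 2 * (p + 1) → v ≤ 60 → v ≤ p + 1)
    {n : ZMod p} (hn : ∀ x : ZMod p, x * x ≠ n) (hD : DicksonList p n)
    {H : Subgroup (GLm p 2)} (hpf : ¬ p ∣ Nat.card H)
    (hfree : ∃ a : Fin 2 → ZMod p, a ≠ 0 ∧
      ∀ h ∈ H, ((h : GLm p 2) : Mat p 2).mulVec a = a → h = 1) :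
    Nat.card (H.map (QuotientGroup.mk' (scalarHom p 2).range)) ≤ p + 1 := by
  rcases hD H hpf with ⟨g, hg⟩ | ⟨g, hg⟩ | hsmall
  · exact image_le_of_conj_monomial hp3 hg hfree
  · exact image_le_of_conj_singerNormal hp3 hn hg hfree
  · refine hP _ ?_ hsmall
    refine dvd_trans ?_ (card_dvd_of_not_dvd hpf)
    exact Dvd.intro_left _ (card_eq_scalar_mul_card_image H).symm

/-- **NO `(2,1)` WITNESS AT A SMALL PRIME WITH `ω(p-1) ≤ 2`, mod Dickson** (`p ≥ 7`, all
`0 < ε ≤ 1`): at a prime where every divisor `≤ 60` of `(p-1)²(p+1)` is `≤ p + 1` and `p - 1` has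
at most two distinct prime factors, no subgroup-TPP triple with a level-one identity design
satisfies the level-one crux inequality. -/
theorem no_levelOne_witness_of_dicksonList_small (hp7 : 7 ≤ p)
    (hP : ∀ v : ℕ, v ∣ (p - 1) ^ 2 * (p + 1) → v ≤ 60 → v ≤ p + 1)
    (hω : (p - 1).primeFactors.card ≤ 2)
    {n : ZMod p} (hn : ∀ x : ZMod p, x * x ≠ n) (hD : DicksonList p n)
    {ε : ℝ} (hε : 0 < ε) (hε1 : ε ≤ 1)
    {H₁ H₂ H₃ : Subgroup (GLm p 2)} (htpp : SubgroupTPP H₁ H₂ H₃)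
    (hdesign : ∃ c : Mat p 2 → ℂ, (∀ M, 1 < M.rank → c M = 0) ∧
      (∑ M, c M * ZMod.stdAddChar (Matrix.trace (M * ((1 : GLm p 2) : Mat p 2)))) = 1 ∧
      ∀ a ∈ H₁, ∀ b ∈ H₂, ∀ g ∈ H₃, a * b * g ≠ 1 →
        (∑ M, c M *
          ZMod.stdAddChar (Matrix.trace (M * ((a * b * g : GLm p 2) : Mat p 2)))) = 0)
 :
    ¬ budget p 2 1 (2 + ε) <
      ((Nat.card H₁ * Nat.card H₂ * Nat.card H₃ : ℕ) : ℝ) ^ ((2 + ε) / 3) := by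
  intro hwit
  have hp3 : 3 ≤ p := by omega
  obtain ⟨-, pf₁, pf₂, pf₃⟩ := levelOne_witness_pfree_profile hp3 hε hε1 htpp hdesign hwit
  obtain ⟨fv₁, fv₂, fv₃⟩ := levelOne_witness_free_vector hp3 hε hε1 htpp hdesign hwit
  exact no_levelOne_witness_of_images_le_of_card_primeFactors hp7 hω hε hε1 htpp hdesign
    (image_le_of_dicksonList_small hp3 hP hn hD pf₁ fv₁)
    (image_le_of_dicksonList_small hp3 hP hn hD pf₂ fv₂)
    (image_le_of_dicksonList_small hp3 hP hn hD pf₃ fv₃) hwit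

/-- `ω(a^k · b^l) ≤ 2` for primes `a, b` (used to discharge `ω(p - 1) ≤ 2` at explicit primes). -/
theorem card_primeFactors_prime_pow_mul_prime_pow_le {a b k l : ℕ} (ha : a.Prime)
    (hb : b.Prime) : (a ^ k * b ^ l).primeFactors.card ≤ 2 := by
  rcases Nat.eq_zero_or_pos k with rfl | hk
  · rcases Nat.eq_zero_or_pos l with rfl | hl
    · simp
    · rw [pow_zero, one_mul, Nat.primeFactors_prime_pow hl.ne' hb]; simp
  rcases Nat.eq_zero_or_pos l with rfl | hl
  · rw [pow_zero, mul_one, Nat.primeFactors_prime_pow hk.ne' ha]; simp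
  rw [Nat.primeFactors_mul (pow_ne_zero _ ha.ne_zero) (pow_ne_zero _ hb.ne_zero),
    Nat.primeFactors_prime_pow hk.ne' ha, Nat.primeFactors_prime_pow hl.ne' hb]
  exact (Finset.card_union_le _ _).trans (by simp)

/-- **`p = 59` is EMPTY mod Dickson** (all `0 < ε ≤ 1`): `58 = 2 · 29`. -/
theorem no_levelOne_witness_fiftynine_of_dicksonList (h59 : p = 59) {n : ZMod p}
    (hn : ∀ x : ZMod p, x * x ≠ n) (hD : DicksonList p n)
    {ε : ℝ} (hε : 0 < ε) (hε1 : ε ≤ 1)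
    {H₁ H₂ H₃ : Subgroup (GLm p 2)} (htpp : SubgroupTPP H₁ H₂ H₃)
    (hdesign : ∃ c : Mat p 2 → ℂ, (∀ M, 1 < M.rank → c M = 0) ∧
      (∑ M, c M * ZMod.stdAddChar (Matrix.trace (M * ((1 : GLm p 2) : Mat p 2)))) = 1 ∧
      ∀ a ∈ H₁, ∀ b ∈ H₂, ∀ g ∈ H₃, a * b * g ≠ 1 →
        (∑ M, c M *
          ZMod.stdAddChar (Matrix.trace (M * ((a * b * g : GLm p 2) : Mat p 2)))) = 0)
 :
    ¬ budget p 2 1 (2 + ε) <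
      ((Nat.card H₁ * Nat.card H₂ * Nat.card H₃ : ℕ) : ℝ) ^ ((2 + ε) / 3) := by
  refine no_levelOne_witness_of_dicksonList_of_card_primeFactors (by omega) ?_ hn hD hε hε1
    htpp hdesign
  rw [h59, show (59 - 1 : ℕ) = 2 ^ 1 * 29 ^ 1 by norm_num]
  exact card_primeFactors_prime_pow_mul_prime_pow_le Nat.prime_two (by norm_num)


/-- The divisor fact at `p = 47`: every divisor `≤ 60` of `46² · 48 = 101568 = 2⁶·3·23²` is
`≤ 48`. -/
theorem divisors_small_fortyseven : ∀ v : ℕ, v ∣ (47 - 1) ^ 2 * (47 + 1) → v ≤ 60 → v ≤ 47 + 1 := by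
  intro v hv h60
  norm_num at hv ⊢
  interval_cases v <;> omega

/-- The divisor fact at `p = 53`: every divisor `≤ 60` of `52² · 54 = 146016 = 2⁵·3³·13²` is
`≤ 54`. -/
theorem divisors_small_fiftythree : ∀ v : ℕ, v ∣ (53 - 1) ^ 2 * (53 + 1) → v ≤ 60 → v ≤ 53 + 1 := by
  intro v hv h60
  norm_num at hv ⊢
  interval_cases v <;> omega

/-- **`p = 47` is EMPTY mod Dickson** (all `0 < ε ≤ 1`): `46 = 2 · 23`. -/
theorem no_levelOne_witness_fortyseven_of_dicksonList (h47 : p = 47) {n : ZMod p}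
    (hn : ∀ x : ZMod p, x * x ≠ n) (hD : DicksonList p n)
    {ε : ℝ} (hε : 0 < ε) (hε1 : ε ≤ 1)
    {H₁ H₂ H₃ : Subgroup (GLm p 2)} (htpp : SubgroupTPP H₁ H₂ H₃)
    (hdesign : ∃ c : Mat p 2 → ℂ, (∀ M, 1 < M.rank → c M = 0) ∧
      (∑ M, c M * ZMod.stdAddChar (Matrix.trace (M * ((1 : GLm p 2) : Mat p 2)))) = 1 ∧
      ∀ a ∈ H₁, ∀ b ∈ H₂, ∀ g ∈ H₃, a * b * g ≠ 1 →
        (∑ M, c M *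
          ZMod.stdAddChar (Matrix.trace (M * ((a * b * g : GLm p 2) : Mat p 2)))) = 0)
 :
    ¬ budget p 2 1 (2 + ε) <
      ((Nat.card H₁ * Nat.card H₂ * Nat.card H₃ : ℕ) : ℝ) ^ ((2 + ε) / 3) := by
  subst h47
  refine no_levelOne_witness_of_dicksonList_small (by norm_num) divisors_small_fortyseven ?_ hn hD
    hε hε1 htpp hdesign
  rw [show (47 - 1 : ℕ) = 2 ^ 1 * 23 ^ 1 by norm_num]
  exact card_primeFactors_prime_pow_mul_prime_pow_le Nat.prime_two (by norm_num)

/-- **`p = 53` is EMPTY mod Dickson** (all `0 < ε ≤ 1`): `52 = 2² · 13`. -/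
theorem no_levelOne_witness_fiftythree_of_dicksonList (h53 : p = 53) {n : ZMod p}
    (hn : ∀ x : ZMod p, x * x ≠ n) (hD : DicksonList p n)
    {ε : ℝ} (hε : 0 < ε) (hε1 : ε ≤ 1)
    {H₁ H₂ H₃ : Subgroup (GLm p 2)} (htpp : SubgroupTPP H₁ H₂ H₃)
    (hdesign : ∃ c : Mat p 2 → ℂ, (∀ M, 1 < M.rank → c M = 0) ∧
      (∑ M, c M * ZMod.stdAddChar (Matrix.trace (M * ((1 : GLm p 2) : Mat p 2)))) = 1 ∧
      ∀ a ∈ H₁, ∀ b ∈ H₂, ∀ g ∈ H₃, a * b * g ≠ 1 →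
        (∑ M, c M *
          ZMod.stdAddChar (Matrix.trace (M * ((a * b * g : GLm p 2) : Mat p 2)))) = 0)
 :
    ¬ budget p 2 1 (2 + ε) <
      ((Nat.card H₁ * Nat.card H₂ * Nat.card H₃ : ℕ) : ℝ) ^ ((2 + ε) / 3) := by
  subst h53
  refine no_levelOne_witness_of_dicksonList_small (by norm_num) divisors_small_fiftythree ?_ hn hD
    hε hε1 htpp hdesign
  rw [show (53 - 1 : ℕ) = 2 ^ 2 * 13 ^ 1 by norm_num]
  exact card_primeFactors_prime_pow_mul_prime_pow_le Nat.prime_two (by norm_num)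

/-! ## The `ε`-thresholds (`p ≥ 59` / `p ≥ 61`) -/

/-- **LOG FORM, mod Dickson** (`p ≥ 59`, `0 < ε < 1`): NO `(2,1)` witness whenever
`3/(1-ε) ≤ (p-2) log(p-1)` — the near-optimal window of `LogGapWindow.gap_of_log_bound`
(e.g. `ε = 0.99`: every `p ≥ 73`; the explicit form below needs `p ≥ 77`). -/
theorem no_levelOne_witness_of_dicksonList_log (hp59 : 59 ≤ p) {n : ZMod p}
    (hn : ∀ x : ZMod p, x * x ≠ n) (hD : DicksonList p n)
    {ε : ℝ} (hε : 0 < ε) (hε1 : ε < 1)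
    (h : 3 / (1 - ε) ≤ ((p : ℝ) - 2) * Real.log ((p : ℝ) - 1))
    {H₁ H₂ H₃ : Subgroup (GLm p 2)} (htpp : SubgroupTPP H₁ H₂ H₃)
    (hdesign : ∃ c : Mat p 2 → ℂ, (∀ M, 1 < M.rank → c M = 0) ∧
      (∑ M, c M * ZMod.stdAddChar (Matrix.trace (M * ((1 : GLm p 2) : Mat p 2)))) = 1 ∧
      ∀ a ∈ H₁, ∀ b ∈ H₂, ∀ g ∈ H₃, a * b * g ≠ 1 →
        (∑ M, c M *
          ZMod.stdAddChar (Matrix.trace (M * ((a * b * g : GLm p 2) : Mat p 2)))) = 0)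
 :
    ¬ budget p 2 1 (2 + ε) <
      ((Nat.card H₁ * Nat.card H₂ * Nat.card H₃ : ℕ) : ℝ) ^ ((2 + ε) / 3) :=
  no_levelOne_witness_of_dicksonList_gap hp59 hn hD hε hε1.le (gap_of_log_bound (by omega) hε1 h)
    htpp hdesign

/-- **EVERY `ε < 1`, mod Dickson: no `(2,1)` witness beyond `p ≥ max(61, 2 + 3/(4(1-ε)))`.**
For each fixed `0 < ε < 1` a subgroup-TPP triple with a level-one identity design can satisfy the
level-one crux inequality only at the finitely many primes `p < 2 + 3/(4(1-ε))` (and, by the rest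
of this file, only at those `≥ 61` with `p ≡ 1 (mod 4)`, `ω(p-1) ≥ 3`, as a family-I triple). -/
theorem no_levelOne_witness_of_dicksonList_explicit (hp61 : 61 ≤ p) {n : ZMod p}
    (hn : ∀ x : ZMod p, x * x ≠ n) (hD : DicksonList p n)
    {ε : ℝ} (hε : 0 < ε) (hε1 : ε < 1) (hpε : 2 + 3 / (4 * (1 - ε)) ≤ (p : ℝ))
    {H₁ H₂ H₃ : Subgroup (GLm p 2)} (htpp : SubgroupTPP H₁ H₂ H₃)
    (hdesign : ∃ c : Mat p 2 → ℂ, (∀ M, 1 < M.rank → c M = 0) ∧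
      (∑ M, c M * ZMod.stdAddChar (Matrix.trace (M * ((1 : GLm p 2) : Mat p 2)))) = 1 ∧
      ∀ a ∈ H₁, ∀ b ∈ H₂, ∀ g ∈ H₃, a * b * g ≠ 1 →
        (∑ M, c M *
          ZMod.stdAddChar (Matrix.trace (M * ((a * b * g : GLm p 2) : Mat p 2)))) = 0) :
    ¬ budget p 2 1 (2 + ε) <
      ((Nat.card H₁ * Nat.card H₂ * Nat.card H₃ : ℕ) : ℝ) ^ ((2 + ε) / 3) :=
  no_levelOne_witness_of_dicksonList_gap (by omega) hn hD hε hε1.le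
    (gap_of_explicit hp61 hε1 hpε) htpp hdesign

/-- **Sharper unconditional-in-`ε` constant, mod Dickson**: no `(2,1)` witness at any `p ≥ 61` for
`0 < ε ≤ 233/236 ≈ 0.9873` (the threshold `2 + 3/(4(1-ε))` is then `≤ 61`; improves the `49/50`
of `DicksonReduction.no_levelOne_witness_of_dicksonList`). -/
theorem no_levelOne_witness_of_dicksonList_sharp (hp61 : 61 ≤ p) {n : ZMod p}
    (hn : ∀ x : ZMod p, x * x ≠ n) (hD : DicksonList p n)
    {ε : ℝ} (hε : 0 < ε) (hε1 : ε ≤ 233 / 236)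
    {H₁ H₂ H₃ : Subgroup (GLm p 2)} (htpp : SubgroupTPP H₁ H₂ H₃)
    (hdesign : ∃ c : Mat p 2 → ℂ, (∀ M, 1 < M.rank → c M = 0) ∧
      (∑ M, c M * ZMod.stdAddChar (Matrix.trace (M * ((1 : GLm p 2) : Mat p 2)))) = 1 ∧
      ∀ a ∈ H₁, ∀ b ∈ H₂, ∀ g ∈ H₃, a * b * g ≠ 1 →
        (∑ M, c M *
          ZMod.stdAddChar (Matrix.trace (M * ((a * b * g : GLm p 2) : Mat p 2)))) = 0) :
    ¬ budget p 2 1 (2 + ε) <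
      ((Nat.card H₁ * Nat.card H₂ * Nat.card H₃ : ℕ) : ℝ) ^ ((2 + ε) / 3) := by
  have hpR : (61 : ℝ) ≤ p := by exact_mod_cast hp61
  have hlt : ε < 1 := by linarith
  refine no_levelOne_witness_of_dicksonList_explicit hp61 hn hD hε hlt ?_ htpp hdesign
  have h1 : 3 / (4 * (1 - ε)) ≤ 59 := by
    rw [div_le_iff₀ (by linarith)]
    linarith
  linarith

/-- **STATUS OF THE `(2,1)` CELL MOD DICKSON (`p ≥ 61`, `0 < ε ≤ 1`), packaged.**  A subgroup-TPP
triple with a level-one identity design satisfying the level-one crux inequality forces: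
`ε > 233/236`; `p < 2 + 3/(4(1-ε))` if `ε < 1`; `p ≡ 1 (mod 4)`; `ω(p-1) ≥ 3` (and, by
`witness_arithmetic_of_dicksonList` / `DicksonFamilyI`, the family-I shape of the triple). -/
theorem witness_status_of_dicksonList (hp61 : 61 ≤ p) {n : ZMod p}
    (hn : ∀ x : ZMod p, x * x ≠ n) (hD : DicksonList p n)
    {ε : ℝ} (hε : 0 < ε) (hε1 : ε ≤ 1)
    {H₁ H₂ H₃ : Subgroup (GLm p 2)} (htpp : SubgroupTPP H₁ H₂ H₃)
    (hdesign : ∃ c : Mat p 2 → ℂ, (∀ M, 1 < M.rank → c M = 0) ∧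
      (∑ M, c M * ZMod.stdAddChar (Matrix.trace (M * ((1 : GLm p 2) : Mat p 2)))) = 1 ∧
      ∀ a ∈ H₁, ∀ b ∈ H₂, ∀ g ∈ H₃, a * b * g ≠ 1 →
        (∑ M, c M *
          ZMod.stdAddChar (Matrix.trace (M * ((a * b * g : GLm p 2) : Mat p 2)))) = 0)
    (hwit : budget p 2 1 (2 + ε) <
      ((Nat.card H₁ * Nat.card H₂ * Nat.card H₃ : ℕ) : ℝ) ^ ((2 + ε) / 3)) :
    233 / 236 < ε ∧ (ε < 1 → (p : ℝ) < 2 + 3 / (4 * (1 - ε))) ∧ p % 4 = 1 ∧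
      3 ≤ (p - 1).primeFactors.card := by
  refine ⟨?_, ?_, (witness_arithmetic_of_dicksonList hp61 hn hD hε hε1 htpp hdesign hwit).1,
    three_le_card_primeFactors_of_dicksonList (by omega) hn hD hε hε1 htpp hdesign hwit⟩
  · by_contra h
    exact no_levelOne_witness_of_dicksonList_sharp hp61 hn hD hε (not_lt.mp h) htpp hdesign hwit
  · intro hlt
    by_contra h
    exact no_levelOne_witness_of_dicksonList_explicit hp61 hn hD hε hlt (not_lt.mp h) htpp
      hdesign hwit

/-! ## One packaged statement for all primes `p ≥ 47` -/

omit hp in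
/-- The primes in `[47, 61)` are `47, 53, 59`. -/
theorem eq_of_prime_of_fortyseven_le {q : ℕ} (hq : q.Prime) (h47 : 47 ≤ q) (h61 : q < 61) :
    q = 47 ∨ q = 53 ∨ q = 59 := by
  interval_cases q <;>
    first
    | exact Or.inl rfl
    | exact Or.inr (Or.inl rfl)
    | exact Or.inr (Or.inr rfl)
    | exact absurd hq (by norm_num)

/-- **STATUS OF THE `(2,1)` CELL FOR ALL PRIMES `p ≥ 47`, mod Dickson** (`0 < ε ≤ 1`): a
subgroup-TPP triple with a level-one identity design satisfying the level-one crux inequality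
forces `p ≥ 61`, `p ≡ 1 (mod 4)`, `ω(p-1) ≥ 3`, `ε > 233/236`, and `p < 2 + 3/(4(1-ε))` if
`ε < 1` (so for each `ε < 1` only finitely many primes remain, and none for `ε ≤ 233/236`).
Conditional on `DicksonList`; primes `p ≤ 43` are not covered; VALUE = THEOREM, NOT summit
progress. -/
theorem witness_status_of_dicksonList_of_fortyseven_le (hp47 : 47 ≤ p) {n : ZMod p}
    (hn : ∀ x : ZMod p, x * x ≠ n) (hD : DicksonList p n)
    {ε : ℝ} (hε : 0 < ε) (hε1 : ε ≤ 1)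
    {H₁ H₂ H₃ : Subgroup (GLm p 2)} (htpp : SubgroupTPP H₁ H₂ H₃)
    (hdesign : ∃ c : Mat p 2 → ℂ, (∀ M, 1 < M.rank → c M = 0) ∧
      (∑ M, c M * ZMod.stdAddChar (Matrix.trace (M * ((1 : GLm p 2) : Mat p 2)))) = 1 ∧
      ∀ a ∈ H₁, ∀ b ∈ H₂, ∀ g ∈ H₃, a * b * g ≠ 1 →
        (∑ M, c M *
          ZMod.stdAddChar (Matrix.trace (M * ((a * b * g : GLm p 2) : Mat p 2)))) = 0)
    (hwit : budget p 2 1 (2 + ε) <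
      ((Nat.card H₁ * Nat.card H₂ * Nat.card H₃ : ℕ) : ℝ) ^ ((2 + ε) / 3)) :
    61 ≤ p ∧ p % 4 = 1 ∧ 3 ≤ (p - 1).primeFactors.card ∧ 233 / 236 < ε ∧
      (ε < 1 → (p : ℝ) < 2 + 3 / (4 * (1 - ε))) := by
  by_cases h61 : 61 ≤ p
  · obtain ⟨h1, h2, h3, h4⟩ := witness_status_of_dicksonList h61 hn hD hε hε1 htpp hdesign hwit
    exact ⟨h61, h3, h4, h1, h2⟩
  · exfalso
    rcases eq_of_prime_of_fortyseven_le hp.out hp47 (not_le.mp h61) with h | h | h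
    · exact no_levelOne_witness_fortyseven_of_dicksonList h hn hD hε hε1 htpp hdesign hwit
    · exact no_levelOne_witness_fiftythree_of_dicksonList h hn hD hε hε1 htpp hdesign hwit
    · exact no_levelOne_witness_fiftynine_of_dicksonList h hn hD hε hε1 htpp hdesign hwit


end CellTwoOneStatus

end Summit.MatrixMultiplication.MatrixMultiplication.Theorems.SubgroupIdentityDesigns.Negative

end
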